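import Summits.Parity.GeneralizedHardyLittlewood.Theorems.BeyondDiagonalBeatsQuarter.OffDiagHeartApprox
import Summits.Parity.GeneralizedHardyLittlewood.Theorems.BeyondDiagonalBeatsQuarter.OffDiagTailsMollified
import Summits.Parity.GeneralizedHardyLittlewood.Theorems.BeyondDiagonalBeatsQuarter.OffDiagDualAssembly
import HarnessLib

/-!
# Route `PrimeLevelFamEdge`, crux K_B (stmt-Parity-20343), line `diagonal_kernel_split` rev 4, plan Ω,
# sub-line **Ω-h (v2) — the heart reduced to a block bound for the FINITE HEAD `r ≤ q⁷` of the layer series,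
# written on the DUAL side (Poisson frequencies `h`, multiplicities `N`)**

Instantiates the approximation transfer of `OffDiagHeartApprox` (Ω-h v1, p638144) with the head of the layer series
at the absolute cut `R = q⁷` (prover-3's W-b (i) `PeterssonSplit.offDiagMollified_add_head_le`: the `r`-tail beyond
`q⁷` is `≤ ε·mainScaleReal`, eventually), and rewrites that head through prover-2's W-a `OffDiagDual.offDiagLayer_eq_dual`
(each layer `r ≥ 1` = its dual series, boxes `i`, frequencies `h`, multiplicity `dualCount`):

* `offDiagHead Δ′ q` (definition, reviewed): `−re(2q̂(2π/q)·Σ_{1≤r≤q⁷} Σ_{l,m≤q̂^{Δ′}} c_l c_m·offDiagLayer q l m r)`, total in `q`;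
* `abs_offDiagMollified_sub_offDiagHead_le` — `|offDiagMollified Δ′ q − offDiagHead Δ′ q| ≤ ε·ms` eventually in prime `q`
  (every `0 < Δ′ ≤ 2`);
* **`offDiagBelowSlack_io_of_headBlockAtCleanScales`** — a block bound `Σ_{q∈goodPrimes Δ′ N} offDiagHead Δ′ q ≤ U·Σ ms`
  (`U < slack`) at clean scales, in the `c′₀`-first quantifier shell, implies `stub_offDiagBelowSlack_io` VERBATIM;
* **`offDiagHead_eq_dual`** — for `q` prime:
  `offDiagHead Δ′ q = −re(2q̂(2π/q)·Σ_{l,m} Σ_{0≤r<q⁷} c_l c_m·Σ_{d₁∣l,d₂∣m} Σ_{i∈ℕ²} Σ_{h∈ℤ²} Φ̂_{i}(h/(q(r+1)))·N_{q(r+1)}((l/d₁),(m/d₂);h))`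
  — the displayed object every remaining Ω-lemma (BLUEPRINT L2–L8) estimates.

Bookkeeping over landed theorems; standard axioms. Helper; closes nothing: the block bound for the head is OPEN (LIVE-Ω).
«The programme SEARCHES and TYPES; no claim about Landau–Siegel zeros, Theorems 1–2 of arXiv:2211.02515 or
a repaired Margin232 until a kernel theorem says so.»
-/

noncomputable section

open Finset Polynomial
open scoped Real

namespace Summit.Parity.GeneralizedHardyLittlewood.Theorems.BeyondDiagonalBeatsQuarter.OffDiag

open Literature.NumberTheory.LFunctions Literature.NumberTheory.LFunctions.KMV2000
open Literature.NumberTheory.Sieve.FriedlanderIwaniecPrimes (fourier2)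
open PeterssonSplit (offDiag offDiagLayer offDiagMollified offDiagMollified_add_head_le)
open OffDiagDual (offDiagLayer_eq_dual)

/-! ### The head at the absolute cut `R = q⁷` -/

/-- **The head of the mollified off-diagonal** at the absolute Petersson cut `r ≤ q⁷`:
`offDiagHead Δ′ q = −re(2q̂(2π/q)·Σ_{1≤r≤q⁷} Σ_{l,m≤⌊q̂^{Δ′}⌋} c_l c_m·offDiagLayer q l m r)` (`0` at `q = 0`).
[cite: KowalskiMichelVanderKam2000, §6 p. 19 and (21)–(23) p. 12; KowalskiMichel2000, §2.4.2 p. 312 — derivation] -/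
def offDiagHead (Δ' : ℝ) (q : ℕ) : ℝ :=
  if hq : q = 0 then 0 else
    (haveI : NeZero q := ⟨hq⟩;
      -(2 * (qhat q : ℂ) * (2 * π / q) *
          ∑ r ∈ Icc 1 (q ^ 7), ∑ l ∈ Icc 1 ⌊qhat q ^ Δ'⌋₊, ∑ m ∈ Icc 1 ⌊qhat q ^ Δ'⌋₊,
            ((mollifierCoeff (X ^ 2) (qhat q ^ Δ') l * mollifierCoeff (X ^ 2) (qhat q ^ Δ') m : ℝ) : ℂ) *
              offDiagLayer q l m r).re)

/-- Unfolding the head at a non-zero level. [cite: KowalskiMichelVanderKam2000, §6 p. 19 — derivation] -/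
theorem offDiagHead_eq (Δ' : ℝ) (q : ℕ) [NeZero q] :
    offDiagHead Δ' q =
      -(2 * (qhat q : ℂ) * (2 * π / q) *
          ∑ r ∈ Icc 1 (q ^ 7), ∑ l ∈ Icc 1 ⌊qhat q ^ Δ'⌋₊, ∑ m ∈ Icc 1 ⌊qhat q ^ Δ'⌋₊,
            ((mollifierCoeff (X ^ 2) (qhat q ^ Δ') l * mollifierCoeff (X ^ 2) (qhat q ^ Δ') m : ℝ) : ℂ) *
              offDiagLayer q l m r).re := by
  unfold offDiagHead
  rw [dif_neg (NeZero.ne q)]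

/-- **The head approximates the mollified off-diagonal to every precision `ε·ms`, eventually**: for every
`ε > 0` there is `q₀` with `|offDiagMollified Δ′ q − offDiagHead Δ′ q| ≤ ε·mainScaleReal Δ′ q` for all primes
`q ≥ q₀` and all `0 < Δ′ ≤ 2` (W-b (i): the `r`-tail beyond `q⁷`).
[cite: KowalskiMichel2000, §2.4.2 p. 312 (23); KowalskiMichelVanderKam2000, (22) p. 12, §6 p. 19 — derivation] -/
theorem abs_offDiagMollified_sub_offDiagHead_le {ε : ℝ} (hε : 0 < ε) :
    ∃ q₀ : ℕ, ∀ q : ℕ, q₀ ≤ q → q.Prime → ∀ Δ' : ℝ, 0 < Δ' → Δ' ≤ 2 →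
      |offDiagMollified Δ' q - offDiagHead Δ' q| ≤ ε * mainScaleReal Δ' q := by
  obtain ⟨q₀, hq₀⟩ := offDiagMollified_add_head_le hε
  refine ⟨q₀, fun q hq0 hq Δ' hΔ0 hΔ2 ↦ ?_⟩
  haveI : NeZero q := ⟨hq.ne_zero⟩
  have h := hq₀ q hq hq0 Δ' hΔ0 hΔ2 (q ^ 7) (by push_cast; exact le_rfl)
  rw [offDiagHead_eq, sub_neg_eq_add]
  exact h

/-- **Ω-h (v2): the heart from a block bound for the HEAD at clean scales.** If for every `c′₀ > 0` there is a
window `b > 1` and, for each `Δ′ ∈ (1,b)`, a tolerance `U < 4(Δ′−1)/Δ′`, a zero-free depth `a₀ > 0`, a conductor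
exponent `η′ < c′₀/a₀` and `N₀` such that at every `(a₀,η′)`-clean scale `N ≥ N₀`
`Σ_{q ∈ goodPrimes Δ′ N} offDiagHead Δ′ q ≤ U·Σ_{q} mainScaleReal Δ′ q`, then `stub_offDiagBelowSlack_io` holds VERBATIM.
[cite: MontgomeryVaughan2007, Cor. 11.10 (Page); KowalskiMichelVanderKam2000, §6 p. 19 — derivation] -/
theorem offDiagBelowSlack_io_of_headBlockAtCleanScales
    (hΩ : ∀ c₀' : ℝ, 0 < c₀' → ∃ b : ℝ, 1 < b ∧ ∀ Δ' : ℝ, 1 < Δ' → Δ' < b →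
      ∃ U : ℝ, U < 4 * (Δ' - 1) / Δ' ∧ ∃ a₀ : ℝ, 0 < a₀ ∧ ∃ η' : ℝ, 0 < η' ∧ η' < c₀' / a₀ ∧
        ∃ N₀ : ℕ, ∀ N : ℕ, N₀ ≤ N → CleanScale a₀ η' N →
          ∑ q ∈ goodPrimes Δ' N, offDiagHead Δ' q ≤ U * ∑ q ∈ goodPrimes Δ' N, mainScaleReal Δ' q) :
    ∃ b : ℝ, 1 < b ∧ ∀ Δ' : ℝ, 1 < Δ' → Δ' < b → ∃ U : ℝ, U < 4 * (Δ' - 1) / Δ' ∧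
      ∀ q₀ : ℕ, ∃ q : ℕ, ∃ _ : NeZero q, q₀ ≤ q ∧ q.Prime ∧
        (∀ n : ℕ, (n : ℝ) ≠ qhat q ^ Δ') ∧
          -(∑ l ∈ Icc 1 ⌊qhat q ^ Δ'⌋₊, ∑ m ∈ Icc 1 ⌊qhat q ^ Δ'⌋₊,
              ((mollifierCoeff (X ^ 2) (qhat q ^ Δ') l * mollifierCoeff (X ^ 2) (qhat q ^ Δ') m : ℝ) : ℂ) *
                offDiag q l m).re ≤ U * mainScaleReal Δ' q :=
  offDiagBelowSlack_io_of_approxBlockAtCleanScales offDiagHead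
    (fun Δ' h1 h2 ε hε ↦ by
      obtain ⟨q₀, hq₀⟩ := abs_offDiagMollified_sub_offDiagHead_le hε
      exact ⟨q₀, fun q hq0 hq ↦ hq₀ q hq0 hq Δ' (lt_trans zero_lt_one h1) h2.le⟩)
    hΩ

/-- The same in the `a₀`-first quantifier order. [cite: MontgomeryVaughan2007, Cor. 11.10 (Page); KowalskiMichelVanderKam2000, §6 p. 19 — derivation] -/
theorem offDiagBelowSlack_io_of_headBlockAtCleanScales_a₀
    (hΩ : ∃ a₀ : ℝ, 0 < a₀ ∧ ∀ η₀ : ℝ, 0 < η₀ → ∃ b : ℝ, 1 < b ∧ ∀ Δ' : ℝ, 1 < Δ' → Δ' < b →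
      ∃ U : ℝ, U < 4 * (Δ' - 1) / Δ' ∧ ∃ η' : ℝ, 0 < η' ∧ η' < η₀ ∧ ∃ N₀ : ℕ, ∀ N : ℕ, N₀ ≤ N →
        CleanScale a₀ η' N →
          ∑ q ∈ goodPrimes Δ' N, offDiagHead Δ' q ≤ U * ∑ q ∈ goodPrimes Δ' N, mainScaleReal Δ' q) :
    ∃ b : ℝ, 1 < b ∧ ∀ Δ' : ℝ, 1 < Δ' → Δ' < b → ∃ U : ℝ, U < 4 * (Δ' - 1) / Δ' ∧
      ∀ q₀ : ℕ, ∃ q : ℕ, ∃ _ : NeZero q, q₀ ≤ q ∧ q.Prime ∧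
        (∀ n : ℕ, (n : ℝ) ≠ qhat q ^ Δ') ∧
          -(∑ l ∈ Icc 1 ⌊qhat q ^ Δ'⌋₊, ∑ m ∈ Icc 1 ⌊qhat q ^ Δ'⌋₊,
              ((mollifierCoeff (X ^ 2) (qhat q ^ Δ') l * mollifierCoeff (X ^ 2) (qhat q ^ Δ') m : ℝ) : ℂ) *
                offDiag q l m).re ≤ U * mainScaleReal Δ' q :=
  offDiagBelowSlack_io_of_approxBlockAtCleanScales_a₀ offDiagHead
    (fun Δ' h1 h2 ε hε ↦ by
      obtain ⟨q₀, hq₀⟩ := abs_offDiagMollified_sub_offDiagHead_le hε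
      exact ⟨q₀, fun q hq0 hq ↦ hq₀ q hq0 hq Δ' (lt_trans zero_lt_one h1) h2.le⟩)
    hΩ

/-! ### The head on the dual side -/

/-- For `Δ′ < 2` and `q ≥ 1`: `⌊q̂^{Δ′}⌋ < q` (indeed `q̂^{Δ′} ≤ q̂² = q/(4π²) < q`). [cite: KowalskiMichelVanderKam2000, §1 p. 1 (q̂) — derivation] -/
theorem floor_qhat_rpow_lt {q : ℕ} (hq : 1 ≤ q) {Δ' : ℝ} (hΔ0 : 0 < Δ') (hΔ2 : Δ' ≤ 2) :
    ⌊qhat q ^ Δ'⌋₊ < q := by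
  have hq0 : (0 : ℝ) < q := by exact_mod_cast hq
  haveI : NeZero q := ⟨by omega⟩
  have hqh : 0 < qhat q := qhat_pos_of_neZero q
  -- `q̂^{Δ′} ≤ max 1 q̂²` and `q̂² = q/(4π²) < q`
  have hsq : qhat q ^ (2 : ℝ) < q := by
    rw [Real.rpow_two]
    unfold qhat
    rw [div_pow, Real.sq_sqrt hq0.le]
    have hπ : (1 : ℝ) < (2 * π) ^ 2 := by nlinarith [Real.pi_gt_three]
    rw [div_lt_iff₀ (by positivity)]
    nlinarith
  have hM : qhat q ^ Δ' < q := by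
    rcases le_or_gt 1 (qhat q) with h1 | h1
    · exact lt_of_le_of_lt (Real.rpow_le_rpow_of_exponent_le h1 hΔ2) hsq
    · calc qhat q ^ Δ' < 1 := Real.rpow_lt_one hqh.le h1 hΔ0
        _ ≤ q := by exact_mod_cast hq
  exact Nat.floor_lt (Real.rpow_nonneg hqh.le _) |>.mpr hM

/-- Re-indexing the head over `r + 1`, `r < q⁷` (the layer at `r = 0` is `0`). [folklore] -/
theorem sum_Icc_offDiagLayer_eq_sum_range {q : ℕ} [NeZero q] (l m R : ℕ) (w : ℂ) :
    ∑ r ∈ Icc 1 R, w * offDiagLayer q l m r = ∑ r ∈ Finset.range R, w * offDiagLayer q l m (r + 1) := by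
  rw [← Finset.mul_sum, ← PeterssonSplit.sum_range_offDiagLayer, Finset.sum_range_succ',
    PeterssonSplit.offDiagLayer_zero, add_zero, Finset.mul_sum]

/-- **The head on the dual side.** For `q` prime (any `Δ′`):
`offDiagHead Δ′ q = −re(2q̂(2π/q)·Σ_{0≤r<q⁷} Σ_{l,m≤⌊q̂^{Δ′}⌋} c_l c_m·Σ_{d₁∣l} Σ_{d₂∣m} Σ_{i∈ℕ²} Σ_{h∈ℤ²}
Φ̂_{q,d₁,d₂,l/d₁,m/d₂,r+1,i}(h₁/(q(r+1)), h₂/(q(r+1)))·N_{q(r+1)}(l/d₁, m/d₂; h₁, h₂))` — W-a's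
`OffDiagDual.offDiagLayer_eq_dual` layer by layer (Petersson modulus `c = q(r+1)`). This is the displayed object that
the remaining Ω-lemmas (OMEGA-BLUEPRINT L2–L8) estimate. [cite: KowalskiMichelVanderKam2000, (21)–(23) p. 12 and Lemma 3.3 p. 9 — derivation] -/
theorem offDiagHead_eq_dual {q : ℕ} [NeZero q] (hq : q.Prime) (Δ' : ℝ) :
    offDiagHead Δ' q =
      -(2 * (qhat q : ℂ) * (2 * π / q) *
          ∑ l ∈ Icc 1 ⌊qhat q ^ Δ'⌋₊, ∑ m ∈ Icc 1 ⌊qhat q ^ Δ'⌋₊, ∑ r ∈ Finset.range (q ^ 7),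
            ((mollifierCoeff (X ^ 2) (qhat q ^ Δ') l * mollifierCoeff (X ^ 2) (qhat q ^ Δ') m : ℝ) : ℂ) *
              ∑ d₁ ∈ l.divisors, ∑ d₂ ∈ m.divisors, ∑' i : ℕ × ℕ, ∑' h : ℤ × ℤ,
                fourier2 (boxWeight q d₁ d₂ (l / d₁) (m / d₂) (r + 1) i)
                    (h.1 / (q * (r + 1) : ℕ)) (h.2 / (q * (r + 1) : ℕ)) *
                  (dualCount (q * (r + 1)) ((l / d₁ : ℕ) : ZMod (q * (r + 1))) ((m / d₂ : ℕ) : ZMod (q * (r + 1)))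
                    (h.1 : ZMod (q * (r + 1))) (h.2 : ZMod (q * (r + 1))) : ℂ)).re := by
  rw [offDiagHead_eq, Finset.sum_comm]
  congr 3
  refine Finset.sum_congr rfl fun l hl ↦ ?_
  rw [Finset.sum_comm]
  refine Finset.sum_congr rfl fun m hm ↦ ?_
  have hl1 : 1 ≤ l := (Finset.mem_Icc.mp hl).1
  have hm1 : 1 ≤ m := (Finset.mem_Icc.mp hm).1
  rw [sum_Icc_offDiagLayer_eq_sum_range]
  refine Finset.sum_congr rfl fun r _ ↦ ?_
  rw [offDiagLayer_eq_dual hq hl1 hm1 (Nat.succ_ne_zero r)]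

end Summit.Parity.GeneralizedHardyLittlewood.Theorems.BeyondDiagonalBeatsQuarter.OffDiag
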